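import Literature.IUT.LogThetaLattice.HodgeTheaterLogLink
import Literature.IUT.LogThetaLattice.ThetaPilotObjects
import HarnessLib

/-!
# Bridge: Def 1.4 log-theta-lattices over a frame → the Def 3.8 (iii) lattice skeleton

Mochizuki, *Inter-universal Teichmüller Theory III*, kurims manuscript (May 2020), Def 1.4 p.45–46,
Def 3.8 (iii) pp.113–114, Rmk 3.8.2 p.115 [cite: Mochizuki2012, III Def 1.4 p.45, Def 3.8 (iii) p.113, Rmk 3.8.2 p.115]
(D-0012 claim key, status disputed; BRIDGE between two landed typings, nothing asserted).

The tree carries two typings of "a collection of distinct `Θ^{±ell}NF`-Hodge theaters indexed by pairs of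
integers whose vertical arrows are full log-links":
* abc-iut-L6-t3's `LogThetaLatticeDiagram L T` (`HodgeTheaterLogLink.lean`, Def 1.4) over a `StripFrame` — the
  log-link is the structure `HTLogLink L X Y` (Def 1.1 (iii) / Prop 1.3 (i): a nonempty poly-isomorphism of
  `D`-Hodge theaters), "full" = `HTLogLink.IsFull`;
* abc-iut-L6-t4's `LGPGaussianLogThetaLattice LogLink IsFull` (`ThetaPilotObjects.lean`, Def 3.8 (iii)) over BARE
  types `HT`, `LogLink : HT → HT → Type`, `IsFull` — the shape consumed by abc-iut-c312-7's
  `Summit.ABC.IUTFork.Cor312.Setting` (fields `HT`/`LogLink`/`IsFull`/`lattice`, "CONTEXT ONLY").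
Rmk 3.8.2 p.115: Thm 1.5 / Def 1.4 "generalize immediately [indeed, "formally"]" to the LGP-Gaussian case; the
Def 3.8 (iii) skeleton records only the theaters, their distinctness and the vertical full log-links (the
horizontal `Θ^{×μ}_{LGP}`-links are full poly-isomorphisms = no data, `LGPGaussianLogThetaLattice.horizontal`).
This file maps the former to the latter (`LogThetaLatticeDiagram.toLGPSkeleton`), so that a `Cor312.Setting`'s
lattice context can be instantiated from any L6-t3 log-theta-lattice: `HT := S.HT`,
`LogLink := HTLogLink L`, `IsFull := HTLogLink.IsFull`, `lattice := Λ.toLGPSkeleton` (MERGE-MAP D12 C9-c: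
t4's lattice is a data-free specialisation of t3's; plan/C312-RESIDUALS.md §1a′ binder `lat`, L6-t3 half).
-/

namespace Literature.IUT.LogThetaLattice

open CategoryTheory
open Literature.IUT.HodgeTheaters

universe u

variable {S : StripFrame.{u}} {L : LogStripData S} {T : ThetaLinkData S}

namespace LogThetaLatticeDiagram

/-- **IUTchIII:Def3.8(iii)** (kurims p.113; Rmk 3.8.2 p.115 "generalize immediately") the Def 3.8 (iii)-shaped
lattice SKELETON of a Def 1.4 log-theta-lattice `Λ` over a frame: theaters `^{n,m}HT := Λ.HT (n, m)` (distinct),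
vertical arrows the full log-links `Λ.vertical n m` (abc-iut-L6-t4's `LGPGaussianLogThetaLattice` over
`HT := S.HT`, `LogLink := HTLogLink L`, `IsFull := HTLogLink.IsFull`). [claim: Mochizuki2012, status: disputed] -/
def toLGPSkeleton (Λ : LogThetaLatticeDiagram L T) :
    LGPGaussianLogThetaLattice (HT := S.HT) (fun X Y => HTLogLink L X Y) (fun ℓ => ℓ.IsFull) where
  theater n m := Λ.HT (n, m)
  distinct _ _ h := Λ.injective h
  logLink n m := Λ.vertical n m
  logLink_full n m := Λ.vertical_isFull n m

variable (Λ : LogThetaLatticeDiagram L T)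

/-- **IUTchIII:Def3.8(iii)** (kurims p.113) the skeleton's theaters are `Λ`'s. [claim: Mochizuki2012, status: disputed] -/
@[simp] theorem toLGPSkeleton_theater (n m : ℤ) : Λ.toLGPSkeleton.theater n m = Λ.HT (n, m) := rfl

/-- **IUTchIII:Def3.8(iii)** (kurims p.113) the skeleton's vertical arrows are `Λ`'s full log-links.
[claim: Mochizuki2012, status: disputed] -/
theorem toLGPSkeleton_logLink (n m : ℤ) : Λ.toLGPSkeleton.logLink n m = Λ.vertical n m := rfl

/-- **IUTchIII:Thm1.5(i)** (kurims p.48) through the bridge, every vertical arrow of the skeleton induces the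
FULL poly-isomorphism of `D`-Hodge theaters (Thm 1.5 (i), vertical coricity, as proved for `Λ`).
[claim: Mochizuki2012, status: disputed] -/
theorem toLGPSkeleton_logLink_inducedDHT_full (n m : ℤ) :
    (Λ.toLGPSkeleton.logLink n m).inducedDHT = PolyIso.full _ _ :=
  Λ.vertical_inducedDHT_full n m

/-- **IUTchIII:Def3.8(iii)** (kurims p.114) the oriented graph of the skeleton (`latticeEdge`, abc-iut-L6-t4) has the
edge `(n, m) → (n, m+1)` of each vertical arrow of `Λ` and `(n, m) → (n+1, m)` of each horizontal one — the
same index conventions as `LatticeArrow` of `FrobeniusPicture.lean` (D12). [claim: Mochizuki2012, status: disputed] -/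
theorem latticeEdge_vertical_horizontal (n m : ℤ) :
    latticeEdge (n, m) (n, m + 1) ∧ latticeEdge (n, m) (n + 1, m) :=
  ⟨Or.inr rfl, Or.inl rfl⟩

end LogThetaLatticeDiagram

end Literature.IUT.LogThetaLattice
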